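import Summits.Ventures.CertifiedManyBodySolver.Downfold.EmeryFermiEnergyBoxCorners
import Summits.Ventures.CertifiedManyBodySolver.Downfold.EmeryFermiEnergyStable
import HarnessLib

/-!
# EVERY PHYSICAL ROW HAS EXACTLY ONE FERMI ENERGY AT EVERY FILLING IN (0, 1) — certificate-free existence (band maximum on the compact
# zone + continuity of the filling at positive energies + the empty band bottom), and the two-corner box rule without existence hypotheses

Venture CertifiedManyBodySolver, cell `pub/hubbard-downfold` (stage S1; INFLATION-RULES-3to1-B §B.83 (j)), seat hubbard-downfold-mod-4 (technique B,
g34); namespace `Summit.Ventures.CertifiedManyBodySolver.Downfold.Emery`. Everything PROVED (0 sorry, no definition). WHAT THIS IS NOT: a statement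
about any material; `U = 0` one-body kinematics of the σ (d–p_x–p_y + t_pp, t_pp′) model; no number lives here.

`EmeryFermiEnergyExists` proved existence INSIDE a certified `pointBracketCheck` window; the levers of §B.83 (f)–(i) quantify over rows without
certificates («the filling is attained at every row of the box»). Here that hypothesis is DISCHARGED once and for all on the physical region
`Δ > 0`, `t_pd ≠ 0`, `t_pp, t_pp′ ≥ 0`:

* §1 `exists_isMaxOn_abEnergyK`: the continuous band attains its maximum `E_max` on the compact quadrant; `abFilling E_max = 1`
  (`abFilling_eq_one_at_max`); `abFilling(1/(n+1)) → 0` (`tendsto_abFilling_zero_right`: measure continuity from above down to the null level set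
  `{ε_AB = 0} = {Γ}`), so some positive energy has filling `< ν`.
* §2 **`exists_fermiEnergy_of_mem_Ioo`**: for every `0 < ν < 1` there is `ε > 0` with `abFilling ε = ν` (intermediate value theorem on `[e₁, E_max]`,
  continuity at positive energies from `EmeryFillingParametric`); with uniqueness (`fermiEnergy_unique`): **`existsUnique_fermiEnergy`**; hence
  `abFilling (fermiEnergyOf ν) = ν` and `0 < fermiEnergyOf ν` UNCONDITIONALLY on the region (`abFilling_fermiEnergyOf'`, `fermiEnergyOf_pos`).
* §3 **THE TWO-CORNER RULE WITHOUT EXISTENCE HYPOTHESES** (`fermiEnergyOf_mem_Icc_of_mem_box'`): for every member of a typed box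
  `[Δ₁, Δ₂] × [a₁, a₂] × [b₁, b₂] × [c₁, c₂]` (`Δ₁, a₁ > 0`, `b₁, c₁ ≥ 0`) and every `0 < ν < 1`:
  `ε_F(Δ₂, a₁, b₁, c₂; ν) ≤ ε_F(Δ, t_pd, t_pp, t_pp′; ν) ≤ ε_F(Δ₁, a₂, b₂, c₁; ν)`.

Sources: three-band model [HybertsenSchluterChristensen1989, Eq. (1)]; extreme value / intermediate value theorems [folklore].
-/

noncomputable section

namespace Summit.Ventures.CertifiedManyBodySolver.Downfold.Emery

open Real MeasureTheory Set Filter Topology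

section All

variable {Δ a b c : ℝ}

/-- The quadrant is compact. [folklore] -/
theorem isCompact_bzQuad : IsCompact bzQuad := isCompact_Icc.prod isCompact_Icc

/-- The continuous antibonding band attains its maximum on the quadrant (`Δ, t_pp, t_pp′ ≥ 0`). [folklore] -/
theorem exists_isMaxOn_abEnergyK (hΔ : 0 ≤ Δ) (hc : 0 ≤ c) (hb : 0 ≤ b) :
    ∃ km ∈ bzQuad, IsMaxOn (abEnergyK Δ a b c) bzQuad km :=
  isCompact_bzQuad.exists_isMaxOn ⟨(0, 0), ⟨⟨le_rfl, pi_pos.le⟩, ⟨le_rfl, pi_pos.le⟩⟩⟩ (continuous_abEnergyK hΔ hc hb).continuousOn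

/-- At the band maximum the filling is `1`. [folklore] -/
theorem abFilling_eq_one_at_max {km : ℝ × ℝ} (hmax : IsMaxOn (abEnergyK Δ a b c) bzQuad km) :
    abFilling Δ a b c (abEnergyK Δ a b c km) = 1 :=
  abFilling_eq_one_of_forall_le fun _ hk => hmax hk

/-- `abFilling(1/(n+1)) → 0`: the occupied volume shrinks to the null level set `{ε_AB = 0}` (`Δ > 0`, `t_pd ≠ 0`, `t_pp, t_pp′ ≥ 0`). [folklore] -/
theorem tendsto_abFilling_zero_right (hΔ : 0 < Δ) (ha : a ≠ 0) (hc : 0 ≤ c) (hb : 0 ≤ b) :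
    Tendsto (fun n : ℕ => abFilling Δ a b c (1 / ((n : ℝ) + 1))) atTop (𝓝 0) := by
  have h := tendsto_volume_subLevel_right Δ a b c 0
  simp only [zero_add] at h
  -- the limit volume is the volume of the occupied set at ε = 0, which is 0
  have h0 : volume (bzQuad ∩ {k | abEnergyK Δ a b c k ≤ 0}) = 0 := by
    have hz := abFilling_zero' hΔ ha hc hb
    unfold abFilling at hz
    rw [abOccSet_eq] at hz
    have hfin : volume (bzQuad ∩ {k | abEnergyK Δ a b c k ≤ 0}) ≠ ⊤ :=
      ne_top_of_le_ne_top volume_bzQuad_ne_top (measure_mono inter_subset_left)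
    have hπ : (0 : ℝ) < π ^ 2 := by positivity
    have htr : (volume (bzQuad ∩ {k | abEnergyK Δ a b c k ≤ 0})).toReal = 0 := by
      rcases div_eq_zero_iff.mp hz with h1 | h1
      · exact h1
      · exact absurd h1 hπ.ne'
    exact (ENNReal.toReal_eq_zero_iff _).mp htr |>.resolve_right hfin
  rw [h0] at h
  have h2 : Tendsto (fun n : ℕ => (volume (bzQuad ∩ {k | abEnergyK Δ a b c k ≤ 1 / ((n : ℝ) + 1)})).toReal / π ^ 2) atTop (𝓝 (0 / π ^ 2)) :=
    ((ENNReal.tendsto_toReal ENNReal.zero_ne_top).comp h).div_const _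
  rw [zero_div] at h2
  have hF : (fun n : ℕ => abFilling Δ a b c (1 / ((n : ℝ) + 1))) =
      fun n : ℕ => (volume (bzQuad ∩ {k | abEnergyK Δ a b c k ≤ 1 / ((n : ℝ) + 1)})).toReal / π ^ 2 := by
    funext n; unfold abFilling; rw [abOccSet_eq]
  rw [hF]; exact h2

/-- **EVERY FILLING IN (0, 1) IS ATTAINED, at a positive energy** (`Δ > 0`, `t_pd ≠ 0`, `t_pp, t_pp′ ≥ 0`; no certificate). [folklore] -/
theorem exists_fermiEnergy_of_mem_Ioo (hΔ : 0 < Δ) (ha : a ≠ 0) (hc : 0 ≤ c) (hb : 0 ≤ b) {ν : ℝ} (hν0 : 0 < ν) (hν1 : ν < 1) :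
    ∃ ε : ℝ, 0 < ε ∧ abFilling Δ a b c ε = ν := by
  obtain ⟨km, hkm, hmax⟩ := exists_isMaxOn_abEnergyK (a := a) hΔ.le hc hb
  set Emax := abEnergyK Δ a b c km with hEmax
  have hFmax : abFilling Δ a b c Emax = 1 := abFilling_eq_one_at_max hmax
  -- a small positive energy with filling < ν
  obtain ⟨n, hn⟩ : ∃ n : ℕ, abFilling Δ a b c (1 / ((n : ℝ) + 1)) < ν := by
    have h := tendsto_abFilling_zero_right hΔ ha hc hb
    exact ((h.eventually (gt_mem_nhds hν0))).exists
  set e₁ : ℝ := 1 / ((n : ℝ) + 1) with he₁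
  have he₁pos : 0 < e₁ := by rw [he₁]; positivity
  -- e₁ ≤ Emax (otherwise the filling at e₁ would already be 1 > ν)
  have hle : e₁ ≤ Emax := by
    by_contra hlt
    push Not at hlt
    have : abFilling Δ a b c Emax ≤ abFilling Δ a b c e₁ := abFilling_mono Δ a b c hlt.le
    linarith
  have hcont : ContinuousOn (abFilling Δ a b c) (Icc e₁ Emax) := fun e he =>
    (continuousAt_abFilling_of_pos hΔ.le (lt_of_lt_of_le he₁pos he.1)).continuousWithinAt
  obtain ⟨ε, hε, hfε⟩ := intermediate_value_Icc hle hcont ⟨hn.le, by rw [hFmax]; exact hν1.le⟩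
  exact ⟨ε, lt_of_lt_of_le he₁pos hε.1, hfε⟩

/-- **EXACTLY ONE FERMI ENERGY** for every physical row and every filling in `(0, 1)`. [folklore] -/
theorem existsUnique_fermiEnergy (hΔ : 0 < Δ) (ha : a ≠ 0) (hc : 0 ≤ c) (hb : 0 ≤ b) {ν : ℝ} (hν0 : 0 < ν) (hν1 : ν < 1) :
    ∃! ε : ℝ, abFilling Δ a b c ε = ν := by
  obtain ⟨ε, -, hε⟩ := exists_fermiEnergy_of_mem_Ioo hΔ ha hc hb hν0 hν1
  exact ⟨ε, hε, fun ε' h' => fermiEnergy_unique hΔ.le hc hb hν0 hν1 h' hε⟩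

/-- `abFilling (fermiEnergyOf ν) = ν` unconditionally on the physical region. [folklore] -/
theorem abFilling_fermiEnergyOf' (hΔ : 0 < Δ) (ha : a ≠ 0) (hc : 0 ≤ c) (hb : 0 ≤ b) {ν : ℝ} (hν0 : 0 < ν) (hν1 : ν < 1) :
    abFilling Δ a b c (fermiEnergyOf Δ a b c ν) = ν := by
  obtain ⟨ε, -, hε⟩ := exists_fermiEnergy_of_mem_Ioo hΔ ha hc hb hν0 hν1
  exact abFilling_fermiEnergyOf hΔ.le hc hb hν0 hν1 ⟨ε, hε⟩

/-- `0 < fermiEnergyOf ν` on the physical region. [folklore] -/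
theorem fermiEnergyOf_pos (hΔ : 0 < Δ) (ha : a ≠ 0) (hc : 0 ≤ c) (hb : 0 ≤ b) {ν : ℝ} (hν0 : 0 < ν) (hν1 : ν < 1) :
    0 < fermiEnergyOf Δ a b c ν :=
  pos_of_abFilling_eq hΔ ha hc hb hν0 (abFilling_fermiEnergyOf' hΔ ha hc hb hν0 hν1)

end All

/-- **THE TWO-CORNER RULE FOR THE FERMI ENERGY OF A TYPED BOX, unconditional form**: for every member of
`[Δ₁, Δ₂] × [a₁, a₂] × [b₁, b₂] × [c₁, c₂]` (`Δ₁ > 0`, `a₁ > 0`, `b₁, c₁ ≥ 0`) and every `0 < ν < 1`,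
`ε_F(Δ₂, a₁, b₁, c₂; ν) ≤ ε_F(Δ, t_pd, t_pp, t_pp′; ν) ≤ ε_F(Δ₁, a₂, b₂, c₁; ν)`. [folklore] -/
theorem fermiEnergyOf_mem_Icc_of_mem_box' {Δ a b c Δ₁ Δ₂ a₁ a₂ b₁ b₂ c₁ c₂ ν : ℝ} (hΔ₁ : 0 < Δ₁) (ha₁ : 0 < a₁) (hb₁ : 0 ≤ b₁)
    (hc₁ : 0 ≤ c₁) (hΔ : Δ ∈ Icc Δ₁ Δ₂) (ha : a ∈ Icc a₁ a₂) (hb : b ∈ Icc b₁ b₂) (hc : c ∈ Icc c₁ c₂) (hν0 : 0 < ν) (hν1 : ν < 1) :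
    fermiEnergyOf Δ a b c ν ∈ Icc (fermiEnergyOf Δ₂ a₁ b₁ c₂ ν) (fermiEnergyOf Δ₁ a₂ b₂ c₁ ν) := by
  refine fermiEnergyOf_mem_Icc_of_mem_box hΔ₁ ha₁ hb₁ hc₁ hΔ ha hb hc hν0 hν1 fun Δ' a' b' c' hΔ' ha' hb' hc' => ?_
  obtain ⟨ε, -, hε⟩ := exists_fermiEnergy_of_mem_Ioo (lt_of_lt_of_le hΔ₁ hΔ'.1) (lt_of_lt_of_le ha₁ ha'.1).ne' (hc₁.trans hc'.1)
    (hb₁.trans hb'.1) hν0 hν1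
  exact ⟨ε, hε⟩

end Summit.Ventures.CertifiedManyBodySolver.Downfold.Emery
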